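import Mathlib
import HarnessLib
import Summits.CriticalPhenomena.PercolationContinuityZ3.Theorems.PercNearOneGluingNoHeavyLowerTailTwoCopyLadderAllGradesLemmaQMain1

/-!
# LEMMA Q — the symmetric double of every ladder side is nonnegative for `q ∈ [0,1]` (part 10 of 10)

Helper files for crux `stmt-CriticalPhenomena-4575` (new-inequality factory `prim-ineq-gen-1`, gen 20); memo
`run/shared/lean/prim/prim-ineq-gen-1/FINDING-28-lemma-Q-tower.md`.  Sequel to `…TwoCopyLadderAllGradesRung` (gen 19), which reduced the
real-`q` rung theorem for ALL ladders (`Bhat q X Y ≥ 0`: Rayleigh negative correlation of the apex edge `av` of `L_r + av` with every rung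
at every `0 < q < 1`) to LEMMA Q: `Qsym q X = Bhat q X X ≥ 0` on the orbit `Orb` of the q-moves (`rungStep`,
    `qpendU`, `qpendW`, `mergeUW`
from `triv`).  METHOD ("self-generated tower"): expanding `Qsym q (move_ρ X)` in powers of the new weight `ρ` produces quartic forms in
the five types; iterating,
    the LP closure over `q ∈ [0,1]` (multipliers and remainders in the Bernstein-type basis `qⁱ(1−q)ʲ`) terminates
with the 12 forms `Qsym, QU3, QU2, QU1, QU3W3, QU3S3, QU1S1` and the mirrors (`mir`,
    `u ↔ w`) of the five non-symmetric ones: every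
`ρ`-coefficient of every form under every move is a nonnegative combination of the 12 forms plus a polynomial that is manifestly
nonnegative for `0 ≤ q ≤ 1` and nonnegative entries (71 exact LP certificates, kit jobs j133358
    + j133934; every identity below is checked by
`ring`).  Hence all 12 forms are nonnegative along the orbit by one simultaneous induction (`goodL_of_orb`,
    last part) — LEMMA Q
(`Qsym_nonneg_of_orb`) — and, with `rung_allq_nonneg_of_Qsym` of gen 19,
    the unconditional real-`q` rung theorem `rung_allq_nonneg`.
NOT formalised: the identification of `Bhat`/`Orb` with the graph polynomials (memo FINDING-26 §1).  (This work,
    2026-08-21.)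
-/

namespace Summit.CriticalPhenomena.PercolationContinuityZ3.Theorems

namespace TwoCopyLadderAllGrades

open TwoCopyLadderCubic

variable {R : Type*} [CommRing R]

/-! ## LEMMA Q: positivity along the orbit -/

section Ordered

variable {S : Type*} [CommRing S] [LinearOrder S] [IsStrictOrderedRing S]

/-- Step of LEMMA Q (`rungStep`, component `hDm`). [this work] -/
theorem goodL_rungStep_Dm {q ρ : S} (_hq : 0 ≤ q) (_hq1 : q ≤ 1) (hρ : 0 ≤ ρ) {X : SVec S} (h : GoodL q X) :
    0 ≤ Dl (mir (rungStep ρ X)) := by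
  obtain ⟨-, -, hm, -, hs, -, -, -, hDm, -, -, -, -, -, -, -, -, -, -, -, -⟩ := h
  rw [Dl_mir_rungStep]; positivity

/-- Step of LEMMA Q (`rungStep`, component `hQ`). [this work] -/
theorem goodL_rungStep_Q {q ρ : S} (_hq : 0 ≤ q) (_hq1 : q ≤ 1) (hρ : 0 ≤ ρ) {X : SVec S} (h : GoodL q X) :
    0 ≤ Qsym q (rungStep ρ X) := by
  obtain ⟨-, -, -, -, -, -, -, -, -, hQ, -, -, -, -, -, -, -, -, -, -, -⟩ := h
  rw [Qsym_rungStep_exp]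
  positivity

/-- Step of LEMMA Q (`rungStep`, component `hU3`). [this work] -/
theorem goodL_rungStep_U3 {q ρ : S} (hq : 0 ≤ q) (hq1 : q ≤ 1) (hρ : 0 ≤ ρ) {X : SVec S} (h : GoodL q X) :
    0 ≤ QU3 q (rungStep ρ X) := by
  obtain ⟨hc, hp, hm, hd, hs, -, -, -, -, hQ, hU3, -, hU2, -, hU1, -, -, hU3S3, -, -, -⟩ := h
  have hq' : (0 : S) ≤ 1 - q := sub_nonneg.mpr hq1
  rw [QU3_rungStep_exp]
  have hn_rungStepn2 : 0 ≤ QU3_rungStep_n2 q X := QU3_rungStep_n2_nonneg hq hq' hc hp hm hd hs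
  positivity

/-- Step of LEMMA Q (`rungStep`, component `hU3m`). [this work] -/
theorem goodL_rungStep_U3m {q ρ : S} (hq : 0 ≤ q) (hq1 : q ≤ 1) (hρ : 0 ≤ ρ) {X : SVec S} (h : GoodL q X) :
    0 ≤ QU3 q (mir (rungStep ρ X)) := by
  obtain ⟨hc, hp, hm, hd, hs, -, -, -, -, hQ, -, hU3m, -, hU2m, -, hU1m, -, -, hU3S3m, -, -⟩ := h
  have hq' : (0 : S) ≤ 1 - q := sub_nonneg.mpr hq1
  have hmc : 0 ≤ (mir X).c := hc
  have hmp : 0 ≤ (mir X).p := hm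
  have hmm : 0 ≤ (mir X).m := hp
  have hmd : 0 ≤ (mir X).d := hd
  have hms : 0 ≤ (mir X).s := hs
  have hQm : 0 ≤ Qsym q (mir X) := by rw [Qsym_mir]; exact hQ
  rw [QU3_mir_rungStep, QU3_rungStep_exp]
  have hn_rungStepn2m : 0 ≤ QU3_rungStep_n2 q (mir X) := QU3_rungStep_n2_nonneg hq hq' hmc hmp hmm hmd hms
  positivity

/-- Step of LEMMA Q (`rungStep`, component `hU2`). [this work] -/
theorem goodL_rungStep_U2 {q ρ : S} (hq : 0 ≤ q) (hq1 : q ≤ 1) (hρ : 0 ≤ ρ) {X : SVec S} (h : GoodL q X) :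
    0 ≤ QU2 q (rungStep ρ X) := by
  obtain ⟨hc, hp, hm, hd, hs, -, -, -, -, hQ, hU3, -, hU2, -, hU1, -, -, hU3S3, -, -, -⟩ := h
  have hq' : (0 : S) ≤ 1 - q := sub_nonneg.mpr hq1
  refine (mul_nonneg_iff_of_pos_left (by norm_num : (0 : S) < 2)).mp ?_
  rw [QU2_rungStep_exp]
  have hn_rungStepn2 : 0 ≤ QU2_rungStep_n2 q X := QU2_rungStep_n2_nonneg hq hq' hc hp hm hd hs
  positivity

/-- Step of LEMMA Q (`rungStep`, component `hU2m`). [this work] -/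
theorem goodL_rungStep_U2m {q ρ : S} (hq : 0 ≤ q) (hq1 : q ≤ 1) (hρ : 0 ≤ ρ) {X : SVec S} (h : GoodL q X) :
    0 ≤ QU2 q (mir (rungStep ρ X)) := by
  obtain ⟨hc, hp, hm, hd, hs, -, -, -, -, hQ, -, hU3m, -, hU2m, -, hU1m, -, -, hU3S3m, -, -⟩ := h
  have hq' : (0 : S) ≤ 1 - q := sub_nonneg.mpr hq1
  have hmc : 0 ≤ (mir X).c := hc
  have hmp : 0 ≤ (mir X).p := hm
  have hmm : 0 ≤ (mir X).m := hp
  have hmd : 0 ≤ (mir X).d := hd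
  have hms : 0 ≤ (mir X).s := hs
  have hQm : 0 ≤ Qsym q (mir X) := by rw [Qsym_mir]; exact hQ
  refine (mul_nonneg_iff_of_pos_left (by norm_num : (0 : S) < 2)).mp ?_
  rw [QU2_mir_rungStep, QU2_rungStep_exp]
  have hn_rungStepn2m : 0 ≤ QU2_rungStep_n2 q (mir X) := QU2_rungStep_n2_nonneg hq hq' hmc hmp hmm hmd hms
  positivity

/-- Step of LEMMA Q (`rungStep`, component `hU1`). [this work] -/
theorem goodL_rungStep_U1 {q ρ : S} (hq : 0 ≤ q) (hq1 : q ≤ 1) (hρ : 0 ≤ ρ) {X : SVec S} (h : GoodL q X) :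
    0 ≤ QU1 q (rungStep ρ X) := by
  obtain ⟨hc, hp, hm, hd, hs, -, -, -, -, -, hU3, -, hU2, -, hU1, -, -, hU3S3, -, hU1S1, -⟩ := h
  have hq' : (0 : S) ≤ 1 - q := sub_nonneg.mpr hq1
  refine (mul_nonneg_iff_of_pos_left (by norm_num : (0 : S) < 2)).mp ?_
  rw [QU1_rungStep_exp]
  have hn_rungStepn2 : 0 ≤ QU1_rungStep_n2 q X := QU1_rungStep_n2_nonneg hq hq' hc hp hm hd hs
  positivity

/-- Step of LEMMA Q (`rungStep`, component `hU1m`). [this work] -/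
theorem goodL_rungStep_U1m {q ρ : S} (hq : 0 ≤ q) (hq1 : q ≤ 1) (hρ : 0 ≤ ρ) {X : SVec S} (h : GoodL q X) :
    0 ≤ QU1 q (mir (rungStep ρ X)) := by
  obtain ⟨hc, hp, hm, hd, hs, -, -, -, -, -, -, hU3m, -, hU2m, -, hU1m, -, -, hU3S3m, -, hU1S1m⟩ := h
  have hq' : (0 : S) ≤ 1 - q := sub_nonneg.mpr hq1
  have hmc : 0 ≤ (mir X).c := hc
  have hmp : 0 ≤ (mir X).p := hm
  have hmm : 0 ≤ (mir X).m := hp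
  have hmd : 0 ≤ (mir X).d := hd
  have hms : 0 ≤ (mir X).s := hs
  refine (mul_nonneg_iff_of_pos_left (by norm_num : (0 : S) < 2)).mp ?_
  rw [QU1_mir_rungStep, QU1_rungStep_exp]
  have hn_rungStepn2m : 0 ≤ QU1_rungStep_n2 q (mir X) := QU1_rungStep_n2_nonneg hq hq' hmc hmp hmm hmd hms
  positivity

/-- Step of LEMMA Q (`rungStep`, component `hU3W3`). [this work] -/
theorem goodL_rungStep_U3W3 {q ρ : S} (hq : 0 ≤ q) (hq1 : q ≤ 1) (hρ : 0 ≤ ρ) {X : SVec S} (h : GoodL q X) :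
    0 ≤ QU3W3 q (rungStep ρ X) := by
  obtain ⟨hc, hp, hm, hd, hs, -, -, -, -, hQ, hU3, hU3m, hU2, -, -, -, hU3W3, -, -, hU1S1, hU1S1m⟩ := h
  have hq' : (0 : S) ≤ 1 - q := sub_nonneg.mpr hq1
  rw [QU3W3_rungStep_exp]
  have hn_rungStepn4 : 0 ≤ QU3W3_rungStep_n4 q X := QU3W3_rungStep_n4_nonneg hq hc hp hm hd hs
  have hn_rungStepn1 : 0 ≤ QU3W3_rungStep_n1 q X := QU3W3_rungStep_n1_nonneg hq hq' hc hp hm hd hs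
  have hn_rungStepn2 : 0 ≤ QU3W3_rungStep_n2 q X := QU3W3_rungStep_n2_nonneg hq hq' hc hp hm hd hs
  have hn_rungStepn3 : 0 ≤ QU3W3_rungStep_n3 q X := QU3W3_rungStep_n3_nonneg hq hq' hc hp hm hd hs
  positivity

/-- Step of LEMMA Q (`rungStep`, component `hU3S3`). [this work] -/
theorem goodL_rungStep_U3S3 {q ρ : S} (_hq : 0 ≤ q) (_hq1 : q ≤ 1) (hρ : 0 ≤ ρ) {X : SVec S} (h : GoodL q X) :
    0 ≤ QU3S3 q (rungStep ρ X) := by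
  obtain ⟨-, -, -, -, -, -, -, -, -, -, -, -, -, -, -, -, -, hU3S3, -, -, -⟩ := h
  rw [QU3S3_rungStep_exp]
  positivity

/-- Step of LEMMA Q (`rungStep`, component `hU3S3m`). [this work] -/
theorem goodL_rungStep_U3S3m {q ρ : S} (_hq : 0 ≤ q) (_hq1 : q ≤ 1) (hρ : 0 ≤ ρ) {X : SVec S} (h : GoodL q X) :
    0 ≤ QU3S3 q (mir (rungStep ρ X)) := by
  obtain ⟨-, -, -, -, -, -, -, -, -, -, -, -, -, -, -, -, -, -, hU3S3m, -, -⟩ := h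
  rw [QU3S3_mir_rungStep, QU3S3_rungStep_exp]
  positivity

/-- Step of LEMMA Q (`rungStep`, component `hU1S1`). [this work] -/
theorem goodL_rungStep_U1S1 {q ρ : S} (hq : 0 ≤ q) (hq1 : q ≤ 1) (hρ : 0 ≤ ρ) {X : SVec S} (h : GoodL q X) :
    0 ≤ QU1S1 q (rungStep ρ X) := by
  obtain ⟨hc, hp, hm, hd, hs, -, -, -, -, hQ, hU3, -, -, -, hU1, -, -, hU3S3, -, hU1S1, -⟩ := h
  have hq' : (0 : S) ≤ 1 - q := sub_nonneg.mpr hq1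
  refine (mul_nonneg_iff_of_pos_left (by norm_num : (0 : S) < 4)).mp ?_
  rw [QU1S1_rungStep_exp]
  have hn_rungStepn1 : 0 ≤ QU1S1_rungStep_n1 q X := QU1S1_rungStep_n1_nonneg hq hq' hc hp hm hd hs
  have hn_rungStepn2 : 0 ≤ QU1S1_rungStep_n2 q X := QU1S1_rungStep_n2_nonneg hq hq' hc hp hm hd hs
  positivity

/-- Step of LEMMA Q (`rungStep`, component `hU1S1m`). [this work] -/
theorem goodL_rungStep_U1S1m {q ρ : S} (hq : 0 ≤ q) (hq1 : q ≤ 1) (hρ : 0 ≤ ρ) {X : SVec S} (h : GoodL q X) :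
    0 ≤ QU1S1 q (mir (rungStep ρ X)) := by
  obtain ⟨hc, hp, hm, hd, hs, -, -, -, -, hQ, -, hU3m, -, -, -, hU1m, -, -, hU3S3m, -, hU1S1m⟩ := h
  have hq' : (0 : S) ≤ 1 - q := sub_nonneg.mpr hq1
  have hmc : 0 ≤ (mir X).c := hc
  have hmp : 0 ≤ (mir X).p := hm
  have hmm : 0 ≤ (mir X).m := hp
  have hmd : 0 ≤ (mir X).d := hd
  have hms : 0 ≤ (mir X).s := hs
  have hQm : 0 ≤ Qsym q (mir X) := by rw [Qsym_mir]; exact hQ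
  refine (mul_nonneg_iff_of_pos_left (by norm_num : (0 : S) < 4)).mp ?_
  rw [QU1S1_mir_rungStep, QU1S1_rungStep_exp]
  have hn_rungStepn1m : 0 ≤ QU1S1_rungStep_n1 q (mir X) := QU1S1_rungStep_n1_nonneg hq hq' hmc hmp hmm hmd hms
  have hn_rungStepn2m : 0 ≤ QU1S1_rungStep_n2 q (mir X) := QU1S1_rungStep_n2_nonneg hq hq' hmc hmp hmm hmd hms
  positivity

/-- A terminal rung preserves the invariant (`0 ≤ q ≤ 1`, `0 ≤ ρ`). [this work] -/
theorem goodL_rungStep {q ρ : S} (hq : 0 ≤ q) (hq1 : q ≤ 1) (hρ : 0 ≤ ρ) {X : SVec S} (h : GoodL q X) :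
    GoodL q (rungStep ρ X) :=
  ⟨goodL_rungStep_c hq hq1 hρ h, goodL_rungStep_p hq hq1 hρ h, goodL_rungStep_m hq hq1 hρ h,
      goodL_rungStep_d hq hq1 hρ h,
    goodL_rungStep_s hq hq1 hρ h, goodL_rungStep_A hq hq1 hρ h, goodL_rungStep_Am hq hq1 hρ h,
        goodL_rungStep_D hq hq1 hρ h,
    goodL_rungStep_Dm hq hq1 hρ h, goodL_rungStep_Q hq hq1 hρ h, goodL_rungStep_U3 hq hq1 hρ h,
        goodL_rungStep_U3m hq hq1 hρ h,
    goodL_rungStep_U2 hq hq1 hρ h, goodL_rungStep_U2m hq hq1 hρ h, goodL_rungStep_U1 hq hq1 hρ h,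
        goodL_rungStep_U1m hq hq1 hρ h,
    goodL_rungStep_U3W3 hq hq1 hρ h, goodL_rungStep_U3S3 hq hq1 hρ h, goodL_rungStep_U3S3m hq hq1 hρ h,
        goodL_rungStep_U1S1 hq hq1 hρ h,
    goodL_rungStep_U1S1m hq hq1 hρ h⟩

/-- Merging the terminals preserves the invariant. [this work] -/
theorem goodL_mergeUW {q : S} (hq : 0 ≤ q) {X : SVec S} (h : GoodL q X) : GoodL q (mergeUW X) := by
  obtain ⟨hc, hp, hm, hd, hs, -, -, -, -, -, -, -, -, -, -, -, -, -, -, -, -⟩ := h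
  refine ⟨?_, ?_, ?_, ?_, ?_, ?_, ?_, ?_, ?_, ?_, ?_, ?_, ?_, ?_, ?_, ?_, ?_, ?_, ?_, ?_, ?_⟩
  · simp only [mergeUW]; positivity
  · simp only [mergeUW]; positivity
  · simp only [mergeUW]; positivity
  · simp only [mergeUW]; positivity
  · simp only [mergeUW]; positivity
  · rw [Aq_mergeUW]
  · rw [Aq_mir_mergeUW]
  · rw [Dl_mergeUW]
  · rw [Dl_mir_mergeUW]
  · rw [Qsym_mergeUW_zero]
  · rw [QU3_mergeUW_exp]
  · rw [QU3_mir_mergeUW]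
  · rw [QU2_mergeUW_exp]
  · rw [QU2_mir_mergeUW]
  · rw [QU1_mergeUW_exp]
  · rw [QU1_mir_mergeUW]
  · rw [QU3W3_mergeUW_exp]; positivity
  · rw [QU3S3_mergeUW_exp]
  · rw [QU3S3_mir_mergeUW]
  · rw [QU1S1_mergeUW_exp]
  · rw [QU1S1_mir_mergeUW]

/-- LEMMA Q (invariant form): every S-vector of the orbit of the q-moves with nonnegative weights satisfies the invariant, for
`0 ≤ q ≤ 1`. [this work] -/
theorem goodL_of_orb {q : S} (hq : 0 ≤ q) (hq1 : q ≤ 1) {X : SVec S} (hX : Orb (fun x : S => 0 ≤ x) q X) : GoodL q X := by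
  induction hX with
  | triv => exact goodL_triv q
  | rung ht _ ih => exact goodL_rungStep hq hq1 ht ih
  | pendU hρ _ ih => exact goodL_qpendU hq hq1 hρ ih
  | pendW hρ _ ih => exact goodL_qpendW hq hq1 hρ ih
  | merge _ ih => exact goodL_mergeUW hq ih

/-- **LEMMA Q.** For `0 ≤ q ≤ 1` the symmetric-double form `Qsym q X = Bhat q X X` (`= P_{G₁ ⊕ G₁'; av,
    uw}/q³` of the symmetric
2-sum of a side with its mirror image) is nonnegative on every q-type vector of the orbit (all ladder sides,
    their pendant/rung extensions and
contraction-minors,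
    arbitrary nonnegative weights).  With `qpolarization` this gives the real-`q` rung theorem for all ladders. [this work] -/
theorem Qsym_nonneg_of_orb {q : S} (hq : 0 ≤ q) (hq1 : q ≤ 1) {X : SVec S} (hX : Orb (fun x : S => 0 ≤ x) q X) :
    0 ≤ Qsym q X :=
  (goodL_of_orb hq hq1 hX).hQ

/-- LEMMA Q for ladder sides with a terminal rung. [this work] -/
theorem Qsym_ladder_nonneg {q t y₁ y₂ : S} (hq : 0 ≤ q) (hq1 : q ≤ 1) (ht : 0 ≤ t) (hy₁ : 0 ≤ y₁) (hy₂ : 0 ≤ y₂)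
    (cols : List (S × S × S)) (h : ∀ trr ∈ cols, 0 ≤ trr.1 ∧ 0 ≤ trr.2.1 ∧ 0 ≤ trr.2.2) :
    0 ≤ Qsym q (rungStep t (qseg q y₁ y₂ cols)) :=
  Qsym_nonneg_of_orb hq hq1 (Orb.rung ht (orb_qseg (P := fun x : S => 0 ≤ x) hy₁ hy₂ cols h))

/-- **THE REAL-q RUNG THEOREM FOR ALL LADDERS** (algebraic form,
    unconditional): for `0 ≤ q ≤ 1` and any two ladder sides (positive
spokes, nonnegative column weights, terminal rungs `t, t'`) the all-`q` rung form `Bhat` — `= P_{L_r+av; av,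
    u_iw_i}(q;y)/q³`, which for
`0 < q < 1` has the sign of the Rayleigh difference `RC[av]·RC[u_iw_i] − RC[av ∧ u_iw_i]` — is nonnegative: the apex edge of every ladder is
Rayleigh-negatively correlated with every rung at every `q ∈ (0,1)` and all positive weights (with THEOREM L∞*: with every edge). [this work] -/
theorem rung_allq_nonneg {q t t' y₁ y₂ z₁ z₂ : S} (hq0 : 0 ≤ q) (hq1 : q ≤ 1) (ht : 0 ≤ t) (ht' : 0 ≤ t')
    (hy₁ : 0 < y₁) (hy₂ : 0 < y₂) (hz₁ : 0 < z₁) (hz₂ : 0 < z₂) (cols cols' : List (S × S × S))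
    (h : ∀ trr ∈ cols, 0 ≤ trr.1 ∧ 0 < trr.2.1 ∧ 0 < trr.2.2) (h' : ∀ trr ∈ cols',
        0 ≤ trr.1 ∧ 0 < trr.2.1 ∧ 0 < trr.2.2) :
    0 ≤ Bhat q (rungStep t (qseg q y₁ y₂ cols)) (rungStep t' (qseg q z₁ z₂ cols')) := by
  have hw : ∀ trr ∈ cols, 0 ≤ trr.1 ∧ 0 ≤ trr.2.1 ∧ 0 ≤ trr.2.2 := fun trr htrr => ⟨(h trr htrr).1,
      (h trr htrr).2.1.le, (h trr htrr).2.2.le⟩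
  have hw' : ∀ trr ∈ cols', 0 ≤ trr.1 ∧ 0 ≤ trr.2.1 ∧ 0 ≤ trr.2.2 :=
    fun trr htrr => ⟨(h' trr htrr).1, (h' trr htrr).2.1.le, (h' trr htrr).2.2.le⟩
  exact rung_allq_nonneg_of_Qsym hq0 hq1 ht ht' hy₁ hy₂ hz₁ hz₂ cols cols' h h'
    (Qsym_ladder_nonneg hq0 hq1 ht hy₁.le hy₂.le cols hw) (Qsym_ladder_nonneg hq0 hq1 ht' hz₁.le hz₂.le cols' hw')

end Ordered

end TwoCopyLadderAllGrades

end Summit.CriticalPhenomena.PercolationContinuityZ3.Theorems
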